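import Mathlib.Analysis.SpecialFunctions.Pow.Deriv
import Mathlib.Analysis.SpecialFunctions.Pow.Continuity
import Mathlib.Analysis.Calculus.Deriv.MeanValue
import Mathlib.Analysis.Calculus.Deriv.Star
import Mathlib.Analysis.Complex.RealDeriv
import Literature.Geometry.Lorentzian.KerrDeSitterTeukolskyRadial
import HarnessLib

/-!
# Partial mode stability of the Teukolsky equation on subextremal Kerr–de Sitter
# (Casals–Teixeira da Costa 2022, Theorem 3.10 ⇒ Theorem 2) — named fact

Source read verbatim: M. Casals, R. Teixeira da Costa, *Hidden spectral symmetries and mode stability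
of subextremal Kerr(-de Sitter) black holes*, Commun. Math. Phys. 394 (2022) 797–832
[CasalsTeixeiradacosta2022], in the authors' arXiv source v3 (2023-05; folder-held TeX), §3:
(3.8)–(3.10), Definition 3.3 (ingoing at `𝓗⁺` / outgoing at `𝓗⁺_c`), Corollary 3.9 (hidden spectral
symmetries, incl. its last sentence on the threshold lines `Re ω = mϖ_j`), Theorem 3.10 and its proof
(energy identity (3.34)–(3.37) and the closing identities
`(ϖ₂/κ₂+ϖ₀/κ₀)/(1/κ₂+1/κ₀) = 2a/(L²Ξ−(r₀+r₂)²)`, `(ϖ₁/κ₁−ϖ₀/κ₀)/(1/κ₁−1/κ₀) = 2a/(L²Ξ−(r₀+r₁)²)`),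
Theorem 2 (introduction).

**Theorem 3.10** (verbatim). "Fix `M > 0`, `|a| < 3/Λ` and `Λ > 0` satisfying (3.1), `½s ∈ ℤ` [sic],
`m − s ∈ ℤ` and `(ω, λ̄)` such that one of the following holds: • `Im ω > 0`, `Im(λ̄ ω̄) ≤ 0` and
`|ω| ∉ |m|(0, (ϖ₂/κ₂+ϖ₀/κ₀)/(1/κ₂+1/κ₀)) ⊊ |m|(0, ϖ₁)`; • `ω ∈ ℝ`, `λ̄ ∈ ℝ` and, if `|s| ≠ ½, 3/2`,
additionally `m = 0` or `ω/m ∉ ((ϖ₁/κ₁−ϖ₀/κ₀)/(1/κ₁−1/κ₀), (ϖ₂/κ₂+ϖ₀/κ₀)/(1/κ₂+1/κ₀)) ⊊ (ϖ₂, ϖ₁)`.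
If `α^{[s]}(r)` is a solution to (3.9) with respect to these parameters which is ingoing at `𝓗⁺`
and outgoing at `𝓗⁺_c`, then `α^{[s]} ≡ 0`." Remark 3.11: "by Lemma 3.1 … the conditions on `λ̄`
which we impose here are verified by the angular eigenvalues associated to mode solutions. Hence,
Theorem 3.10 implies, and is stronger than, Theorem 2."

## What is vendored (and how)

ONE named fact `CasalsTeixeiraDaCosta2022_partialModeStability`: Theorem 3.10 as the radial ODE
statement it is, over the vocabulary of `KerrDeSitterTeukolskyRadial.lean` (STU/Hatsuda radial
function and separation constant `λ`; CTdC's `λ̄ = lambdaBar λ`, the two printed radial equations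
being literally the same — `radialPotential_eq_ctdc`, proved by `ring`), with the thresholds in the
closed form `2a/(a² + 3/Λ − (r₀ + r_j)²)` printed in Theorem 2 / end of the proof (`r₀ = rMinus`,
`r₁ = rPlus`, `r₂ = rCosmo`), `0 ≤ a` explicit (the superradiant intervals `(ϖ₂, ϖ₁)` presuppose it;
`a < 0` is the image under `(a, m) ↦ (−a, −m)`), and RESTRICTED to the regime in which the printed
Definition 3.3 uses the generic boundary exponents at both horizons — `(Re ω ≠ mϖ₁ ∨ s ≤ 0)` and
`(Re ω ≠ mϖ₂ ∨ s ≥ 0)` — where "ingoing at `𝓗⁺`"/"outgoing at `𝓗⁺_c`" ARE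
`IsIngoingAtEventHorizon`/`IsOutgoingAtCosmoHorizon` (module docstring of the radial file). On the
complementary threshold rays (`Re ω = mϖ₁ ∧ s > 0`, `Re ω = mϖ₂ ∧ s < 0`) Definition 3.3 uses the
exponents `−(s+1)/2`, `(s−1)/2` for their `R` and the printed theorem then concerns a different class
of functions (by Corollary 3.9 it speaks about the spin `−s` companion equation there); nothing is
vendored about those rays. -- TODO(general form): the threshold-ray cases of Thm 3.10/Cor 3.9.

A SECOND named fact `CasalsTeixeiraDaCosta2022_angularSign` renders Lemma 3.1's display (3.7)
(`Im ν > 0 ⟹ Im(ν̄ λ̄) < 0` for angular eigenvalues; at `ν = aω`, `a > 0`: `Im(λ̄ ω̄) < 0`), which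
discharges the `λ̄`-hypothesis of Theorem 3.10 for genuine modes (`window_of_hasMode`).

Proved here: the coefficient identity `radialPotential_eq_ctdc`, and the corollary `.window`
(a non-trivial generic-regime mode with `Im ω > 0`, `Im(λ̄ω̄) ≤ 0` has `0 < |ω| < |m|·Ω_SR`), which is
the "finite reduction in `ω`" used by box certificates (venture `Summits/Ventures/KdS`).

DISCHARGED here (last section): `CasalsTeixeiraDaCosta2022_angularSign_holds` proves the second named
fact by the printed argument of Lemma 3.1 (the `sin θ · conj(ν S)`-weighted energy identity), rendered
in boundary-flux (differential) form so that no improper integral is needed: with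
`P = (1+αx²)(1−x²)` and `G = Im(ν̄ P S' S̄)`, `G' = −P|S'|² Im ν − |S|² Im(ν̄ V)`, the pointwise
integrand `Im(ν̄(V − λ̄)) = Im ν · (Ξ³x²|ν|²/Δ_θ + N)`, `N ≥ 0` being exactly the printed sum of
non-negative terms (`angularPotential_sub_lambdaBar`), and `G → 0` at both poles for the admissible
Frobenius branches (`tendsto_boundaryFlux_of_branch`); so `Im(ν̄ λ̄) ≥ 0` would make `G` antitone
from `0` to `0` with `G' < 0` somewhere (`false_of_antitone_flux`). Theorem 3.10 itself
(`CasalsTeixeiraDaCosta2022_partialModeStability`) remains a named fact.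
-/

noncomputable section

open Complex Set

namespace Literature.Geometry.Lorentzian.KerrDeSitter

/-! ### Casals–Teixeira da Costa's partial mode stability (Theorem 3.10), as a named fact -/

/-- Casals–Teixeira da Costa's separation constant `λ̄` expressed through the STU/Hatsuda constant
`λ` used in this file: the printed radial equations CTdC (3.8) (with `μ = 1`) and STU (3.7) have the
same coefficients except for the constant terms `s(1 − a²/L²) − λ̄ + 2Ξ²amω − a²Ξ²ω²` versus
`2s(1−α) − λ`, so they are the same equation iff `λ̄ = λ − s(1−α) + Ξ²(2amω − a²ω²)`
(`radialPotential_eq_ctdc`). [cite: CasalsTeixeiradacosta2022, (3.8)] -/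
def lambdaBar (a Λ s : ℝ) (ω : ℂ) (m : ℝ) (lam : ℂ) : ℂ :=
  lam - ((s * (1 - alpha a Λ) : ℝ) : ℂ) +
    (xi a Λ : ℂ) ^ 2 * (2 * (a : ℂ) * (m : ℂ) * ω - (a : ℂ) ^ 2 * ω ^ 2)

/-- The zeroth-order coefficient of CTdC's radial equation (3.8) at `μ = 1`, written with their
separation constant `λ̄`: `(1/Δ)[Ξ²K² − isΞKΔ'] + 4isωΞr − (2/L²)(1+3s+2s²)r² + s(1−a²/L²) − λ̄`
`+ 2Ξ²amω − a²Ξ²ω²` (`1/L² = Λ/3`). [cite: CasalsTeixeiradacosta2022, (3.8)] -/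
def radialPotentialCTdC (M a Λ s : ℝ) (ω : ℂ) (m : ℝ) (lamBar : ℂ) (r : ℝ) : ℂ :=
  ((xi a Λ : ℂ) ^ 2 * radialK a ω m r ^ 2 -
        I * (s : ℂ) * (xi a Λ : ℂ) * radialK a ω m r * (deltaDeriv M a Λ r : ℂ)) /
      (delta M a Λ r : ℂ) +
    4 * I * (s : ℂ) * ω * (xi a Λ : ℂ) * (r : ℂ) -
    ((2 * (Λ / 3) * (1 + 3 * s + 2 * s ^ 2) * r ^ 2 : ℝ) : ℂ) +
    ((s * (1 - a ^ 2 * (Λ / 3)) : ℝ) : ℂ) - lamBar +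
    2 * (xi a Λ : ℂ) ^ 2 * (a : ℂ) * (m : ℂ) * ω - (a : ℂ) ^ 2 * (xi a Λ : ℂ) ^ 2 * ω ^ 2

/-- The two printed radial equations coincide under `λ̄ = lambdaBar λ`: STU (3.7) = Hatsuda (2.13)
(`radialPotential`, constant `λ`) and CTdC (3.8) at `μ = 1` (`radialPotentialCTdC`, constant `λ̄`).
[cite: CasalsTeixeiradacosta2022, (3.8)] -/
theorem radialPotential_eq_ctdc (M a Λ s : ℝ) (ω : ℂ) (m : ℝ) (lam : ℂ) (r : ℝ) :
    radialPotential M a Λ s ω m lam r =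
      radialPotentialCTdC M a Λ s ω m (lambdaBar a Λ s ω m lam) r := by
  simp only [radialPotential, radialPotentialCTdC, lambdaBar, alpha, xi]
  push_cast
  ring

/-- The horizon angular velocity `ϖ_j = a/(r_j² + a²)` of the horizon `r = r_j`.
[cite: CasalsTeixeiradacosta2022, (3.10)] -/
def horizonAngVel (a rh : ℝ) : ℝ := a / (rh ^ 2 + a ^ 2)

/-- Casals–Teixeira da Costa's upper superradiant threshold
`(ϖ₂/κ₂ + ϖ₀/κ₀)/(1/κ₂ + 1/κ₀) = 2a/(L²Ξ − (r₀ + r₂)²) = 2a/(a² + 3/Λ − (r₀ + r₂)²)`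
(`r₀` the Cauchy horizon `rMinus`, `r₂` the cosmological horizon `rCosmo`; the identity is printed at
the end of the proof of Theorem 3.10, and the right-hand side is the form of Theorem 2): for
`Im ω > 0` mode solutions can only have `|ω| ∈ |m|·(0, Ω_SR)`.
[cite: CasalsTeixeiradacosta2022, Theorem 2 and proof of Theorem 3.10] -/
def superradiantUpper (M a Λ : ℝ) : ℝ :=
  2 * a / (a ^ 2 + 3 / Λ - (rMinus M a Λ + rCosmo M a Λ) ^ 2)

/-- The lower real-axis threshold `(ϖ₁/κ₁ − ϖ₀/κ₀)/(1/κ₁ − 1/κ₀) = 2a/(a² + 3/Λ − (r₀ + r₁)²)`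
(`r₁` the event horizon `rPlus`). [cite: CasalsTeixeiradacosta2022, Theorem 2 and proof of Theorem 3.10] -/
def superradiantLower (M a Λ : ℝ) : ℝ :=
  2 * a / (a ^ 2 + 3 / Λ - (rMinus M a Λ + rPlus M a Λ) ^ 2)

/-- **Casals–Teixeira da Costa 2022, Theorem 3.10 (partial mode stability of the Teukolsky equation
on subextremal Kerr–de Sitter), in the generic-boundary regime.** As printed in the authors' latest arXiv version (v3, 2023) of CMP 394 (2022) 797–832:
"Fix `M > 0`, `|a| < 3/Λ` and `Λ > 0` satisfying (3.1), `s ∈ ½ℤ`, `m − s ∈ ℤ` and `(ω, λ̄)` such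
that one of the following holds: • `Im ω > 0`, `Im(λ̄ ω̄) ≤ 0` and
`|ω| ∉ |m|(0, (ϖ₂/κ₂+ϖ₀/κ₀)/(1/κ₂+1/κ₀)) ⊊ |m|(0, ϖ₁)`; • `ω ∈ ℝ`, `λ̄ ∈ ℝ` and, if
`|s| ≠ ½, 3/2`, additionally `m = 0` or
`ω/m ∉ ((ϖ₁/κ₁−ϖ₀/κ₀)/(1/κ₁−1/κ₀), (ϖ₂/κ₂+ϖ₀/κ₀)/(1/κ₂+1/κ₀)) ⊊ (ϖ₂, ϖ₁)`. If `α(r)` is a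
solution to (3.9) with respect to these parameters which is ingoing at `𝓗⁺` and outgoing at
`𝓗⁺_c`, then `α ≡ 0`." (thresholds `= 2a/(L²Ξ − (r₀+r_j)²)`, end of the proof; implies their
Theorem 2). RENDERED: with the tree's `IsSubextremal` for "(3.1), `M > 0`, `Λ > 0`", `0 ≤ a`
(the paper's superradiant intervals presuppose `a ≥ 0`; `a < 0` follows by `(a, m) ↦ (−a, −m)`),
BOTH the binder `|a| < 3/Λ` as printed in Theorems 2/3.10 AND `a² < 3/Λ` — the printed `|a| < 3/Λ`
is a dimensional misprint for the standing hypothesis `|a| < L`, `L² = 3/Λ`, of §3.1, Def. 3.4 and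
Cor. 3.9 ("Fix `M > 0`, `L > 0` and `|a| < L` satisfying (3.1)"); keeping both only adds hypotheses,

`λ̄ = lambdaBar λ` (`radialPotential_eq_ctdc`), and ONLY in the regime where their Definition 3.3
uses the generic boundary exponents at both horizons — `(Re ω ≠ mϖ₁ or s ≤ 0)` and
`(Re ω ≠ mϖ₂ or s ≥ 0)` — where "ingoing at `𝓗⁺`/outgoing at `𝓗⁺_c`" are exactly
`IsIngoingAtEventHorizon`/`IsOutgoingAtCosmoHorizon`; on the complementary threshold rays the printed
definition uses other exponents and this fact says nothing. Conclusion: the radial function vanishes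
on `(r₊, r_c)`. Named fact; users take `(h : CasalsTeixeiraDaCosta2022_partialModeStability)`.
[cite: CasalsTeixeiradacosta2022, Theorem 3.10] -/
def CasalsTeixeiraDaCosta2022_partialModeStability : Prop :=
  ∀ (M a Λ s : ℝ) (ω : ℂ) (m : ℝ) (lam : ℂ), IsSubextremal M a Λ → 0 ≤ a → |a| < 3 / Λ →
    a ^ 2 < 3 / Λ →
    (∃ k : ℤ, 2 * s = k) → (∃ k : ℤ, m - s = k) →
    ((0 < ω.im ∧ (lambdaBar a Λ s ω m lam * (starRingEnd ℂ) ω).im ≤ 0 ∧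
        ¬(0 < ‖ω‖ ∧ ‖ω‖ < |m| * superradiantUpper M a Λ)) ∨
      (ω.im = 0 ∧ (lambdaBar a Λ s ω m lam).im = 0 ∧
        ((∃ k : ℤ, 2 * |s| = k ∧ (k = 1 ∨ k = 3)) ∨ m = 0 ∨
          ¬(superradiantLower M a Λ < ω.re / m ∧ ω.re / m < superradiantUpper M a Λ)))) →
    (ω.re ≠ m * horizonAngVel a (rPlus M a Λ) ∨ s ≤ 0) →
    (ω.re ≠ m * horizonAngVel a (rCosmo M a Λ) ∨ 0 ≤ s) →
    ∀ R : ℝ → ℂ, IsRadialTeukolskySolution M a Λ s ω m lam R →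
      IsIngoingAtEventHorizon M a Λ s ω m R → IsOutgoingAtCosmoHorizon M a Λ ω m R →
        ∀ r ∈ Ioo (rPlus M a Λ) (rCosmo M a Λ), R r = 0

/-- Consequence used box by box: in the generic-boundary regime, a Kerr–de Sitter Teukolsky mode with
`Im ω > 0` whose separation constant satisfies `Im(λ̄ ω̄) ≤ 0` has `0 < |ω| < |m|·Ω_SR` — so a
certificate only has to exclude modes in that bounded window (plus the threshold rays).
[cite: CasalsTeixeiradacosta2022, Theorem 3.10] -/
theorem CasalsTeixeiraDaCosta2022_partialModeStability.window
    (h : CasalsTeixeiraDaCosta2022_partialModeStability) {M a Λ s : ℝ} {ω : ℂ} {m : ℝ} {lam : ℂ}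
    (hsub : IsSubextremal M a Λ) (ha : 0 ≤ a) (haL : |a| < 3 / Λ) (haL2 : a ^ 2 < 3 / Λ)
    (hs : ∃ k : ℤ, 2 * s = k)
    (hm : ∃ k : ℤ, m - s = k) (hω : 0 < ω.im)
    (hlam : (lambdaBar a Λ s ω m lam * (starRingEnd ℂ) ω).im ≤ 0)
    (h1 : ω.re ≠ m * horizonAngVel a (rPlus M a Λ) ∨ s ≤ 0)
    (h2 : ω.re ≠ m * horizonAngVel a (rCosmo M a Λ) ∨ 0 ≤ s) {R : ℝ → ℂ}
    (hR : IsRadialTeukolskySolution M a Λ s ω m lam R) (hin : IsIngoingAtEventHorizon M a Λ s ω m R)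
    (hout : IsOutgoingAtCosmoHorizon M a Λ ω m R) (hnt : ∃ r ∈ Ioo (rPlus M a Λ) (rCosmo M a Λ), R r ≠ 0) :
    0 < ‖ω‖ ∧ ‖ω‖ < |m| * superradiantUpper M a Λ := by
  by_contra hw
  obtain ⟨r, hr, hne⟩ := hnt
  exact hne (h M a Λ s ω m lam hsub ha haL haL2 hs hm (Or.inl ⟨hω, hlam, hw⟩) h1 h2 R hR hin hout r hr)

/-! ### The sign of `Im(λ̄ ω̄)` for angular eigenvalues (Lemma 3.1, display (3.7)) — named fact -/

/-- **Casals–Teixeira da Costa 2022, Lemma 3.1, display (3.7).** As printed (arXiv v3, §3.2.1, for the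
angular equation (3.6) with parameter `ν ∈ ℂ` in place of `aω` and the boundary condition that
`e^{imφ}S` is a non-trivial smooth `s`-spin-weighted function, `s ∈ ½ℤ`, `m − s ∈ ℤ`): "The eigenvalues
are independent of `sign s` and satisfy `Im ν > 0 ⟹ Im(ν̄ λ̄) < 0`." The printed proof — "multiplying
the angular ODE by `sin θ · conj(ν S)`, integrating by parts and taking the real part … the right hand
side is clearly non-negative if `Im ν > 0`. In fact, it is only zero if `S ≡ 0`" — applies to every
non-trivial solution regular at both poles. RENDERED at `ν = aω` with `a > 0` (then
`Im ν > 0 ⟺ Im ω > 0` and `Im(ν̄ λ̄) = a · Im(λ̄ ω̄)`), `Λ > 0` (the paper's standing Kerr–de Sitter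
setting, `Ξ − 1 = a²Λ/3 ≥ 0` enters the positivity), in the Teukolsky vocabulary of
`KerrDeSitterTeukolskyRadial.lean` (`μ = 1`, `λ̄ = lambdaBar λ`; the master form of
`KerrDeSitterMasterEquations.lean` identifies the two): if `λ` is an angular eigenvalue
(`IsAngularEigenvalue a Λ s ω m λ`) and `Im ω > 0` then `Im(λ̄ ω̄) < 0`. This discharges, for genuine
mode solutions, the hypothesis `Im(λ̄ ω̄) ≤ 0` of `CasalsTeixeiraDaCosta2022_partialModeStability`
(Remark 3.11: "the conditions on `λ̄` which we impose here are verified by the angular eigenvalues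
associated to mode solutions"). Named fact; users take `(h : CasalsTeixeiraDaCosta2022_angularSign)`.
[cite: CasalsTeixeiradacosta2022, Lemma 3.1] -/
def CasalsTeixeiraDaCosta2022_angularSign : Prop :=
  ∀ (a Λ s : ℝ) (ω : ℂ) (m : ℝ) (lam : ℂ), 0 < Λ → 0 < a → (∃ k : ℤ, 2 * s = k) →
    (∃ k : ℤ, m - s = k) → 0 < ω.im → IsAngularEigenvalue a Λ s ω m lam →
      (lambdaBar a Λ s ω m lam * (starRingEnd ℂ) ω).im < 0

/-- **Finite reduction in `ω` for geometric modes** (Theorem 3.10 + Lemma 3.1, i.e. the content of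
Theorem 2 for `Im ω > 0`): in the generic-boundary regime, a Kerr–de Sitter Teukolsky mode
(`HasMode`) with `Im ω > 0` and rotation `a > 0` has `0 < |ω| < |m| · Ω_SR`,
`Ω_SR = 2a/(a² + 3/Λ − (r₀ + r₂)²)` — so only that bounded window (and the threshold rays) is left
to a certificate. [cite: CasalsTeixeiradacosta2022, Theorem 2] -/
theorem CasalsTeixeiraDaCosta2022_partialModeStability.window_of_hasMode
    (h : CasalsTeixeiraDaCosta2022_partialModeStability) (hsign : CasalsTeixeiraDaCosta2022_angularSign)
    {M a Λ s : ℝ} {ω : ℂ} {m : ℝ} (hsub : IsSubextremal M a Λ) (ha : 0 < a) (haL : |a| < 3 / Λ)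
    (haL2 : a ^ 2 < 3 / Λ) (hs : ∃ k : ℤ, 2 * s = k) (hm : ∃ k : ℤ, m - s = k) (hω : 0 < ω.im)
    (h1 : ω.re ≠ m * horizonAngVel a (rPlus M a Λ) ∨ s ≤ 0)
    (h2 : ω.re ≠ m * horizonAngVel a (rCosmo M a Λ) ∨ 0 ≤ s) (hmode : HasMode M a Λ s ω m) :
    0 < ‖ω‖ ∧ ‖ω‖ < |m| * superradiantUpper M a Λ := by
  obtain ⟨lam, R, hang, hR, hin, hout, hne⟩ := hmode
  have hlam : (lambdaBar a Λ s ω m lam * (starRingEnd ℂ) ω).im ≤ 0 :=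
    (hsign a Λ s ω m lam hsub.2.1 ha hs hm hω hang).le
  exact h.window hsub ha.le haL haL2 hs hm hω hlam h1 h2 hR hin hout hne

section AngularSignProof

open Filter Topology
open scoped ComplexConjugate

/-! ### Proof of Lemma 3.1 (3.7): the boundary-flux form of the printed energy identity -/

/-- Boundary behaviour of an admissible Frobenius branch. If on an open set `J` (one side of `x₀`)
`S = u^{k/2}·g` with `u` affine (`u' ≡ c`), `u > 0` on `J`, `u(x₀) = 0`, `k ≥ 0`, `g` smooth on an open
`U ⊇ J` containing `x₀`, and `S` is differentiable on `J` with derivative `S'`, then the flux density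
`u · S' · conj S` tends to `0` as `x → x₀` within `J` (it equals `(ck/2)u^k|g|² + u^{k+1}g'ḡ` on `J`).
This is the vanishing of the boundary terms in the integration by parts of the printed proof.
[cite: CasalsTeixeiradacosta2022, Lemma 3.1 (proof)] -/
theorem tendsto_boundaryFlux_of_branch
    {U J : Set ℝ} {x₀ : ℝ} (hU : IsOpen U) (hx₀ : x₀ ∈ U) (hJ : IsOpen J) (hJU : J ⊆ U)
    {g : ℝ → ℂ} (hg : ContDiffOn ℝ ((⊤ : ℕ∞) : WithTop ℕ∞) g U)
    {u : ℝ → ℝ} {c : ℝ} (hu : ∀ x, HasDerivAt u c x) (hu0 : u x₀ = 0) (hupos : ∀ x ∈ J, 0 < u x)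
    {k : ℝ} (hk : 0 ≤ k) {S S' : ℝ → ℂ} (hS : ∀ x ∈ J, HasDerivAt S (S' x) x)
    (hSg : ∀ x ∈ J, S x = (((u x) ^ (k / 2) : ℝ) : ℂ) * g x) :
    Tendsto (fun x => ((u x : ℝ) : ℂ) * S' x * conj (S x)) (𝓝[J] x₀) (𝓝 0) := by
  have h1 : (1 : WithTop ℕ∞) ≤ ((⊤ : ℕ∞) : WithTop ℕ∞) := by exact_mod_cast le_top
  have h0 : ((⊤ : ℕ∞) : WithTop ℕ∞) ≠ 0 := by simp
  have hgd : DifferentiableOn ℝ g U := hg.differentiableOn h0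
  have hgc : ContinuousAt g x₀ :=
    (hgd.continuousOn.continuousWithinAt hx₀).continuousAt (hU.mem_nhds hx₀)
  have hg'c : ContinuousAt (deriv g) x₀ :=
    ((hg.continuousOn_deriv_of_isOpen hU h1).continuousWithinAt hx₀).continuousAt (hU.mem_nhds hx₀)
  -- the derivative of `S` on `J`, from the branch representation
  have hS' : ∀ x ∈ J, S' x = ((c * (k / 2) * (u x) ^ (k / 2 - 1) : ℝ) : ℂ) * g x +
      (((u x) ^ (k / 2) : ℝ) : ℂ) * deriv g x := by
    intro x hx
    have hgx : HasDerivAt g (deriv g x) x :=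
      ((hgd x (hJU hx)).differentiableAt (hU.mem_nhds (hJU hx))).hasDerivAt
    have hux : HasDerivAt (fun y => (u y) ^ (k / 2)) (c * (k / 2) * (u x) ^ (k / 2 - 1)) x :=
      (hu x).rpow_const (Or.inl (hupos x hx).ne')
    have hprod := hux.ofReal_comp.fun_mul hgx
    have heq : S =ᶠ[𝓝 x] fun y => (((u y) ^ (k / 2) : ℝ) : ℂ) * g y :=
      Filter.eventually_of_mem (hJ.mem_nhds hx) fun y hy => hSg y hy
    exact (hS x hx).unique (hprod.congr_of_eventuallyEq heq)
  -- the flux density on `J`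
  have hflux : ∀ x ∈ J, ((u x : ℝ) : ℂ) * S' x * conj (S x) =
      ((c * k / 2 * (u x) ^ k : ℝ) : ℂ) * (g x * conj (g x)) +
        (((u x) ^ (k + 1) : ℝ) : ℂ) * (deriv g x * conj (g x)) := by
    intro x hx
    have hU0 : 0 < u x := hupos x hx
    have e1 : (u x) ^ (k / 2) * (u x) ^ (k / 2) = (u x) ^ k := by
      rw [← Real.rpow_add hU0]; congr 1; ring
    have e2 : (u x) ^ (k / 2 - 1) = (u x) ^ (k / 2) / u x := Real.rpow_sub_one hU0.ne' _
    have r1 : u x * (u x) ^ (k / 2 - 1) * (u x) ^ (k / 2) = (u x) ^ k := by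
      rw [e2, ← e1]; field_simp
    have r2 : u x * (u x) ^ (k / 2) * (u x) ^ (k / 2) = (u x) ^ (k + 1) := by
      rw [Real.rpow_add_one hU0.ne', mul_assoc, e1]; ring
    rw [hS' x hx, hSg x hx, ← r1, ← r2]
    simp only [map_mul, Complex.conj_ofReal]
    push_cast
    ring
  -- the model expression tends to `0`
  have hu_t : Tendsto u (𝓝 x₀) (𝓝 0) := by
    simpa [hu0] using (hu x₀).continuousAt.tendsto
  have t1 : Tendsto (fun x => c * k / 2 * (u x) ^ k) (𝓝 x₀) (𝓝 0) := by
    rcases hk.eq_or_lt with h0 | hpos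
    · simp [← h0]
    · simpa using (hu_t.rpow_const_nhds_zero hpos).const_mul (c * k / 2)
  have t2 : Tendsto (fun x => (u x) ^ (k + 1)) (𝓝 x₀) (𝓝 0) :=
    hu_t.rpow_const_nhds_zero (by linarith)
  have t3 : Tendsto g (𝓝 x₀) (𝓝 (g x₀)) := hgc.tendsto
  have t3c : Tendsto (fun x => conj (g x)) (𝓝 x₀) (𝓝 (conj (g x₀))) :=
    (Complex.continuous_conj.tendsto _).comp t3
  have t4 : Tendsto (deriv g) (𝓝 x₀) (𝓝 (deriv g x₀)) := hg'c.tendsto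
  have tM : Tendsto (fun x => ((c * k / 2 * (u x) ^ k : ℝ) : ℂ) * (g x * conj (g x)) +
      (((u x) ^ (k + 1) : ℝ) : ℂ) * (deriv g x * conj (g x))) (𝓝 x₀) (𝓝 0) := by
    have := (t1.ofReal.mul (t3.mul t3c)).add (t2.ofReal.mul (t4.mul t3c))
    simpa using this
  refine (tM.mono_left nhdsWithin_le_nhds).congr' ?_
  filter_upwards [self_mem_nhdsWithin] with x hx
  exact (hflux x hx).symm

/-- The one-dimensional skeleton of the argument: a real function on `(−1, 1)` with non-positive
derivative, negative somewhere, cannot tend to `0` at both endpoints (the skeleton of the printed positivity argument).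
[cite: CasalsTeixeiradacosta2022, Lemma 3.1 (proof)] -/
theorem false_of_antitone_flux {G G' : ℝ → ℝ}
    (hderiv : ∀ x ∈ Ioo (-1 : ℝ) 1, HasDerivAt G (G' x) x) (hnonpos : ∀ x ∈ Ioo (-1 : ℝ) 1, G' x ≤ 0)
    (hneg : ∃ x ∈ Ioo (-1 : ℝ) 1, G' x < 0) (hleft : Tendsto G (𝓝[>] (-1)) (𝓝 0))
    (hright : Tendsto G (𝓝[<] 1) (𝓝 0)) : False := by
  have hDo : IsOpen (Ioo (-1 : ℝ) 1) := isOpen_Ioo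
  have hint : interior (Ioo (-1 : ℝ) 1) = Ioo (-1) 1 := hDo.interior_eq
  have hcont : ContinuousOn G (Ioo (-1 : ℝ) 1) := fun x hx =>
    (hderiv x hx).continuousAt.continuousWithinAt
  have hanti : AntitoneOn G (Ioo (-1 : ℝ) 1) := by
    apply antitoneOn_of_hasDerivWithinAt_nonpos (convex_Ioo _ _) hcont
    · intro x hx; rw [hint] at hx ⊢; exact (hderiv x hx).hasDerivWithinAt
    · intro x hx; rw [hint] at hx; exact hnonpos x hx
  have hle : ∀ x ∈ Ioo (-1 : ℝ) 1, G x ≤ 0 := by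
    intro x hx
    have hev : ∀ᶠ y in 𝓝[>] (-1 : ℝ), G x ≤ G y := by
      filter_upwards [Ioo_mem_nhdsGT hx.1] with y hy
      exact hanti ⟨hy.1, hy.2.trans hx.2⟩ hx hy.2.le
    exact ge_of_tendsto hleft hev
  have hge : ∀ x ∈ Ioo (-1 : ℝ) 1, 0 ≤ G x := by
    intro x hx
    have hev : ∀ᶠ y in 𝓝[<] (1 : ℝ), G y ≤ G x := by
      filter_upwards [Ioo_mem_nhdsLT hx.2] with y hy
      exact hanti hx ⟨hx.1.trans hy.1, hy.2⟩ hy.1.le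
    exact le_of_tendsto hright hev
  obtain ⟨x₀, hx₀, hneg₀⟩ := hneg
  have hzero : G =ᶠ[𝓝 x₀] fun _ => (0 : ℝ) := by
    filter_upwards [hDo.mem_nhds hx₀] with y hy
    exact le_antisymm (hle y hy) (hge y hy)
  have h0 : HasDerivAt G 0 x₀ := (hasDerivAt_const x₀ (0 : ℝ)).congr_of_eventuallyEq hzero
  have := (hderiv x₀ hx₀).unique h0
  linarith

/-- Imaginary part of the derivative of the flux `conj c · (P|S'|² − V|S|²)`, split at `λ̄`
(pure algebra). [cite: CasalsTeixeiradacosta2022, Lemma 3.1 (proof)] -/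
theorem im_fluxDeriv_eq (c lamBar v z z' : ℂ) (P : ℝ) :
    (conj c * ((P : ℂ) * (z' * conj z') - v * (z * conj z))).im =
      -(P * normSq z' * c.im) - normSq z * (conj c * lamBar).im -
        normSq z * (conj c * (v - lamBar)).im := by
  rw [Complex.mul_conj, Complex.mul_conj]
  simp only [mul_im, mul_re, sub_im, sub_re, ofReal_re, ofReal_im, conj_re, conj_im]
  ring

/-- **The angular energy (boundary-flux) argument of Casals–Teixeira da Costa, Lemma 3.1**, for the
Sturm–Liouville operator `d/dx (1+αx²)(1−x²) d/dx + V(x)` on `(−1, 1)` with an arbitrary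
zeroth-order coefficient `V`: if `S ≢ 0` is a classical solution, regular at both poles (admissible
Frobenius branches), and for some `c` with `Im c > 0` and `λ̄` the quantity `Im(c̄ (V(x) − λ̄))` is
`≥ 0` on `(−1,1)` and `> 0` off `x = 0`, then `Im(c̄ λ̄) < 0`. Printed as the integrated identity
"multiplying the angular ODE by `sin θ · conj(ν S)`, integrating by parts and taking the real part …
the right hand side is clearly non-negative if `Im ν > 0` … only zero if `S ≡ 0`"; rendered here in
differential form: `G = Im(c̄ P S' S̄)` has `G' = −P|S'|² Im c − |S|² Im(c̄ V) ≤ 0` if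
`Im(c̄ λ̄) ≥ 0`, `< 0` somewhere, while `G → 0` at both poles — impossible
(`false_of_antitone_flux`). [cite: CasalsTeixeiradacosta2022, Lemma 3.1 (proof)] -/
theorem im_conj_mul_neg_of_angularODE {α : ℝ} (hα : 0 ≤ α) {s m : ℝ} {c lamBar : ℂ}
    (hc : 0 < c.im) {V S S' S'' : ℝ → ℂ}
    (hS : ∀ x ∈ Ioo (-1 : ℝ) 1, HasDerivAt S (S' x) x ∧ HasDerivAt S' (S'' x) x ∧
      (((1 + α * x ^ 2) * (1 - x ^ 2) : ℝ) : ℂ) * S'' x +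
          ((2 * (α - 1) * x - 4 * α * x ^ 3 : ℝ) : ℂ) * S' x + V x * S x = 0)
    (hreg : IsRegularAtPoles s m S) (hnt : ∃ x ∈ Ioo (-1 : ℝ) 1, S x ≠ 0)
    (hW : ∀ x ∈ Ioo (-1 : ℝ) 1, 0 ≤ (conj c * (V x - lamBar)).im)
    (hW' : ∀ x ∈ Ioo (-1 : ℝ) 1, x ≠ 0 → 0 < (conj c * (V x - lamBar)).im) :
    (conj c * lamBar).im < 0 := by
  by_contra hcon
  rw [not_lt] at hcon
  -- a point off the origin where `S ≠ 0`
  obtain ⟨x₀, hx₀D, hx₀0, hSx₀⟩ : ∃ x₀ ∈ Ioo (-1 : ℝ) 1, x₀ ≠ 0 ∧ S x₀ ≠ 0 := by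
    obtain ⟨x₁, hx₁, hS₁⟩ := hnt
    by_cases h : x₁ = 0
    · subst h
      have hcont : ContinuousAt S 0 := (hS 0 hx₁).1.continuousAt
      have hev : ∀ᶠ x in 𝓝 (0 : ℝ), S x ≠ 0 ∧ x ∈ Ioo (-1 : ℝ) 1 :=
        (hcont.eventually_ne hS₁).and (isOpen_Ioo.mem_nhds hx₁)
      have hev' : ∀ᶠ x in 𝓝[≠] (0 : ℝ), (S x ≠ 0 ∧ x ∈ Ioo (-1 : ℝ) 1) ∧ x ∈ ({0}ᶜ : Set ℝ) :=
        (hev.filter_mono nhdsWithin_le_nhds).and self_mem_nhdsWithin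
      obtain ⟨x, ⟨hSx, hxD⟩, hx0⟩ := hev'.exists
      exact ⟨x, hxD, hx0, hSx⟩
    · exact ⟨x₁, hx₁, h, hS₁⟩
  -- positivity of the Sturm–Liouville weight on `(−1, 1)`
  have hPnn : ∀ x ∈ Ioo (-1 : ℝ) 1, 0 ≤ (1 + α * x ^ 2) * (1 - x ^ 2) := by
    intro x hx
    have : 0 ≤ 1 - x ^ 2 := by nlinarith [hx.1, hx.2]
    positivity
  refine false_of_antitone_flux
    (G := fun x => (conj c * ((((1 + α * x ^ 2) * (1 - x ^ 2) : ℝ) : ℂ) * S' x * conj (S x))).im)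
    (G' := fun x => (conj c * ((((1 + α * x ^ 2) * (1 - x ^ 2) : ℝ) : ℂ) * (S' x * conj (S' x)) -
        V x * (S x * conj (S x)))).im) ?_ ?_ ?_ ?_ ?_
  · -- `G` is differentiable with derivative `G'` (the ODE enters here)
    intro x hx
    obtain ⟨h1, h2, hode⟩ := hS x hx
    have hPr : HasDerivAt (fun y : ℝ => (1 + α * y ^ 2) * (1 - y ^ 2))
        (2 * (α - 1) * x - 4 * α * x ^ 3) x := by
      have hp : HasDerivAt (fun y : ℝ => y ^ 2) (2 * x) x := by simpa using hasDerivAt_pow 2 x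
      exact (((hp.const_mul α).const_add 1).fun_mul (hp.const_sub 1)).congr_deriv (by ring)
    have hSbar : HasDerivAt (fun y => conj (S y)) (conj (S' x)) x := by simpa using h1.star
    have hprod := ((hPr.ofReal_comp.fun_mul h2).fun_mul hSbar).const_mul (conj c)
    have hF : HasDerivAt
        (fun y => conj c * ((((1 + α * y ^ 2) * (1 - y ^ 2) : ℝ) : ℂ) * S' y * conj (S y)))
        (conj c * ((((1 + α * x ^ 2) * (1 - x ^ 2) : ℝ) : ℂ) * (S' x * conj (S' x)) -
          V x * (S x * conj (S x)))) x := by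
      refine hprod.congr_deriv ?_
      linear_combination (conj c * conj (S x)) * hode
    simpa only [Function.comp_def, Complex.imCLM_apply] using
      (Complex.imCLM.hasFDerivAt.comp_hasDerivAt x hF)
  · -- `G' ≤ 0`
    intro x hx
    simp only [im_fluxDeriv_eq c lamBar]
    have t1 := mul_nonneg (mul_nonneg (hPnn x hx) (normSq_nonneg (S' x))) hc.le
    have t2 := mul_nonneg (normSq_nonneg (S x)) hcon
    have t3 := mul_nonneg (normSq_nonneg (S x)) (hW x hx)
    linarith
  · -- `G' x₀ < 0`
    refine ⟨x₀, hx₀D, ?_⟩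
    simp only [im_fluxDeriv_eq c lamBar]
    have t1 := mul_nonneg (mul_nonneg (hPnn x₀ hx₀D) (normSq_nonneg (S' x₀))) hc.le
    have t2 := mul_nonneg (normSq_nonneg (S x₀)) hcon
    have t3 := mul_pos (Complex.normSq_pos.mpr hSx₀) (hW' x₀ hx₀D hx₀0)
    linarith
  · -- `G → 0` at `x = −1` (regular branch `(1+x)^{|m−s|/2}`)
    obtain ⟨ε, hε, g, hg, hSg⟩ := hreg.1
    have hb : (-1 : ℝ) < min (-1 + ε) 1 := lt_min (by linarith) (by norm_num)
    have hflux := tendsto_boundaryFlux_of_branch (x₀ := -1) (U := Ioo (-1 - ε) (-1 + ε))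
      (J := Ioo (-1) (min (-1 + ε) 1)) isOpen_Ioo ⟨by linarith, by linarith⟩ isOpen_Ioo
      (fun x hx => ⟨by linarith [hx.1], lt_of_lt_of_le hx.2 (min_le_left _ _)⟩) hg
      (u := fun x => 1 + x) (c := 1) (fun x => (hasDerivAt_id' x).const_add 1) (by norm_num)
      (fun x hx => by linarith [hx.1]) (abs_nonneg (m - s))
      (fun x hx => (hS x ⟨hx.1, lt_of_lt_of_le hx.2 (min_le_right _ _)⟩).1)
      (fun x hx => by
        rw [Complex.ofReal_cpow (by linarith [hx.1])]
        exact hSg x ⟨hx.1, lt_of_lt_of_le hx.2 (min_le_left _ _)⟩)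
    have hcts : Tendsto (fun x : ℝ => (((1 - x) * (1 + α * x ^ 2) : ℝ) : ℂ)) (𝓝 (-1))
        (𝓝 ((((1 - (-1)) * (1 + α * (-1) ^ 2) : ℝ) : ℂ))) :=
      (continuous_ofReal.comp (by fun_prop)).tendsto (-1)
    have hlim : Tendsto (fun x => (conj c * ((((1 - x) * (1 + α * x ^ 2) : ℝ) : ℂ) *
        (((1 + x : ℝ) : ℂ) * S' x * conj (S x)))).im) (𝓝[Ioo (-1) (min (-1 + ε) 1)] (-1)) (𝓝 0) := by
      have := ((hcts.mono_left nhdsWithin_le_nhds).mul hflux).const_mul (conj c)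
      simpa only [Function.comp_def, mul_zero, Complex.zero_im] using
        (Complex.continuous_im.tendsto _).comp this
    rw [nhdsWithin_Ioo_eq_nhdsGT hb] at hlim
    refine hlim.congr' (Eventually.of_forall fun x => ?_)
    simp only
    congr 1
    push_cast
    ring
  · -- `G → 0` at `x = 1` (regular branch `(1−x)^{|m+s|/2}`)
    obtain ⟨ε, hε, g, hg, hSg⟩ := hreg.2
    have hb : max (1 - ε) (-1) < (1 : ℝ) := max_lt (by linarith) (by norm_num)
    have hflux := tendsto_boundaryFlux_of_branch (x₀ := 1) (U := Ioo (1 - ε) (1 + ε))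
      (J := Ioo (max (1 - ε) (-1)) 1) isOpen_Ioo ⟨by linarith, by linarith⟩ isOpen_Ioo
      (fun x hx => ⟨lt_of_le_of_lt (le_max_left _ _) hx.1, by linarith [hx.2]⟩) hg
      (u := fun x => 1 - x) (c := -1) (fun x => (hasDerivAt_id' x).const_sub 1) (by norm_num)
      (fun x hx => by linarith [hx.2]) (abs_nonneg (m + s))
      (fun x hx => (hS x ⟨lt_of_le_of_lt (le_max_right _ _) hx.1, hx.2⟩).1)
      (fun x hx => by
        rw [Complex.ofReal_cpow (by linarith [hx.2])]
        exact hSg x ⟨lt_of_le_of_lt (le_max_left _ _) hx.1, hx.2⟩)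
    have hcts : Tendsto (fun x : ℝ => (((1 + x) * (1 + α * x ^ 2) : ℝ) : ℂ)) (𝓝 1)
        (𝓝 ((((1 + 1) * (1 + α * 1 ^ 2) : ℝ) : ℂ))) :=
      (continuous_ofReal.comp (by fun_prop)).tendsto 1
    have hlim : Tendsto (fun x => (conj c * ((((1 + x) * (1 + α * x ^ 2) : ℝ) : ℂ) *
        (((1 - x : ℝ) : ℂ) * S' x * conj (S x)))).im) (𝓝[Ioo (max (1 - ε) (-1)) 1] 1) (𝓝 0) := by
      have := ((hcts.mono_left nhdsWithin_le_nhds).mul hflux).const_mul (conj c)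
      simpa only [Function.comp_def, mul_zero, Complex.zero_im] using
        (Complex.continuous_im.tendsto _).comp this
    rw [nhdsWithin_Ioo_eq_nhdsLT hb] at hlim
    refine hlim.congr' (Eventually.of_forall fun x => ?_)
    simp only
    congr 1
    push_cast
    ring

/-! ### The pointwise sign of `Im(ν̄ (V − λ̄))` for the Teukolsky angular potential (`μ = 1`) -/

/-- Casals–Teixeira da Costa's grouping of the angular potential minus `λ̄` (their (3.6) at `μ = 1`,
`ν = aω`; by `masterAngularPotential_one` the same function as Hatsuda's (2.5)), as displayed in
the proof of Lemma 3.1: `V(x) − λ̄ = A(x)ν² + B(x)ν − N(x)` with `A = Ξ³x²/Δ_θ`,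
`B = −2Ξ²x(αmx + s)/Δ_θ` real and
`N = [2(Ξ−1)x²(1+2s²)(1−x²)Δ_θ + (Ξm + sx(Ξ − 2(Ξ−1)(1−x²)))²]/(Δ_θ(1−x²))`
(`Δ_θ = 1 + αx²`, `x = cos θ`, `sin²θ = 1 − x²`). [cite: CasalsTeixeiradacosta2022, Lemma 3.1 (proof)] -/
theorem angularPotential_sub_lambdaBar (a Λ s : ℝ) (ω : ℂ) (m : ℝ) (lam : ℂ) {x : ℝ}
    (h0 : 1 + alpha a Λ ≠ 0) (hx1 : 1 + alpha a Λ * x ^ 2 ≠ 0) (hx2 : 1 - x ^ 2 ≠ 0) :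
    angularPotential a Λ s ω m lam x - lambdaBar a Λ s ω m lam =
      ((xi a Λ ^ 3 * x ^ 2 / (1 + alpha a Λ * x ^ 2) : ℝ) : ℂ) * ((a : ℂ) * ω) ^ 2 +
        ((-(2 * xi a Λ ^ 2 * x * (alpha a Λ * m * x + s)) / (1 + alpha a Λ * x ^ 2) : ℝ) : ℂ) *
          ((a : ℂ) * ω) -
        (((2 * alpha a Λ * x ^ 2 * (1 + 2 * s ^ 2) * (1 - x ^ 2) * (1 + alpha a Λ * x ^ 2) +
            (xi a Λ * m + s * x * (xi a Λ - 2 * alpha a Λ * (1 - x ^ 2))) ^ 2) /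
          ((1 + alpha a Λ * x ^ 2) * (1 - x ^ 2)) : ℝ) : ℂ) := by
  have hxi : xi a Λ = 1 + alpha a Λ := rfl
  have h0' : (1 + (alpha a Λ : ℂ)) ≠ 0 := by exact_mod_cast h0
  have hx1' : (1 + (alpha a Λ : ℂ) * (x : ℂ) ^ 2) ≠ 0 := by exact_mod_cast hx1
  have hx2' : (1 - (x : ℂ) ^ 2) ≠ 0 := by exact_mod_cast hx2
  simp only [angularPotential, lambdaBar, hxi]
  push_cast
  field_simp
  ring

/-- `Im(c̄ (A c² + B c − N)) = Im c · (A|c|² + N)` for real `A, B, N` (the `B`-term is real and drops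
out). [cite: CasalsTeixeiradacosta2022, Lemma 3.1 (proof)] -/
theorem im_conj_mul_quadratic (c : ℂ) (A B N : ℝ) :
    (conj c * ((A : ℂ) * c ^ 2 + (B : ℂ) * c - (N : ℂ))).im = c.im * (A * normSq c + N) := by
  simp only [pow_two, mul_im, mul_re, add_im, add_re, sub_im, sub_re, ofReal_re, ofReal_im,
    conj_re, conj_im, normSq_apply]
  ring

/-- The integrand of the printed identity, pointwise: for `x = cos θ ∈ (−1, 1)`,
`Im(ν̄ (V(x) − λ̄)) = Im ν · (Ξ³x²|ν|²/Δ_θ + N(x))` with `N ≥ 0` as in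
`angularPotential_sub_lambdaBar` (`ν = aω`). [cite: CasalsTeixeiradacosta2022, Lemma 3.1 (proof)] -/
theorem im_conj_mul_angularPotential_sub_lambdaBar (a : ℝ) {Λ : ℝ} (hΛ : 0 ≤ Λ) (s : ℝ) (ω : ℂ)
    (m : ℝ) (lam : ℂ) {x : ℝ} (hx : x ∈ Ioo (-1 : ℝ) 1) :
    (conj ((a : ℂ) * ω) * (angularPotential a Λ s ω m lam x - lambdaBar a Λ s ω m lam)).im =
      ((a : ℂ) * ω).im * (xi a Λ ^ 3 * x ^ 2 / (1 + alpha a Λ * x ^ 2) * normSq ((a : ℂ) * ω) +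
        (2 * alpha a Λ * x ^ 2 * (1 + 2 * s ^ 2) * (1 - x ^ 2) * (1 + alpha a Λ * x ^ 2) +
            (xi a Λ * m + s * x * (xi a Λ - 2 * alpha a Λ * (1 - x ^ 2))) ^ 2) /
          ((1 + alpha a Λ * x ^ 2) * (1 - x ^ 2))) := by
  have hα : 0 ≤ alpha a Λ := by unfold alpha; positivity
  have hx2 : 0 < 1 - x ^ 2 := by nlinarith [hx.1, hx.2]
  have hx1 : 0 < 1 + alpha a Λ * x ^ 2 := by positivity
  have h0 : 0 < 1 + alpha a Λ := by positivity
  rw [angularPotential_sub_lambdaBar a Λ s ω m lam h0.ne' hx1.ne' hx2.ne', im_conj_mul_quadratic]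

/-! ### Lemma 3.1 (3.7) discharged -/

/-- **Casals–Teixeira da Costa 2022, Lemma 3.1, display (3.7) — proved.** For `Λ > 0`, `a > 0`,
`Im ω > 0` and an angular eigenvalue `λ` of the Kerr–de Sitter angular Teukolsky equation
(Hatsuda (2.5), non-trivial solution regular at both poles), `Im(λ̄ ω̄) < 0` with
`λ̄ = lambdaBar λ` (CTdC's constant). The printed proof (energy identity obtained by multiplying the
angular ODE by `sin θ · conj(ν S)`, integrating by parts and taking real parts; its right-hand side is
a sum of manifestly non-negative terms, zero only for `S ≡ 0`) is followed in boundary-flux form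
(`im_conj_mul_neg_of_angularODE` with the pointwise integrand
`im_conj_mul_angularPotential_sub_lambdaBar`); the hypotheses `2s ∈ ℤ`, `m − s ∈ ℤ` of the named
fact are not needed for (3.7). Discharges `CasalsTeixeiraDaCosta2022_angularSign`.
[cite: CasalsTeixeiradacosta2022, Lemma 3.1] -/
theorem CasalsTeixeiraDaCosta2022_angularSign_holds : CasalsTeixeiraDaCosta2022_angularSign := by
  intro a Λ s ω m lam hΛ ha _hs _hm hω hang
  obtain ⟨S, ⟨S', S'', hS⟩, hreg, hnt⟩ := hang
  have hα : 0 ≤ alpha a Λ := by unfold alpha; positivity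
  have hξ : 0 < xi a Λ := xi_pos hΛ.le a
  have hcim : 0 < ((a : ℂ) * ω).im := by simpa [mul_im] using mul_pos ha hω
  have hnc : 0 < normSq ((a : ℂ) * ω) := by
    refine Complex.normSq_pos.mpr fun h => ?_
    rw [h] at hcim
    simp at hcim
  have key := im_conj_mul_neg_of_angularODE hα hcim (s := s) (m := m)
    (V := fun x => angularPotential a Λ s ω m lam x) (lamBar := lambdaBar a Λ s ω m lam)
    hS hreg hnt ?_ ?_
  · have hid : (conj ((a : ℂ) * ω) * lambdaBar a Λ s ω m lam).im =
        a * (lambdaBar a Λ s ω m lam * conj ω).im := by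
      simp only [map_mul, Complex.conj_ofReal, mul_im, mul_re, ofReal_re, ofReal_im, conj_re,
        conj_im]
      ring
    rw [hid] at key
    exact neg_of_mul_neg_right key ha.le
  · intro x hx
    have hx2 : 0 < 1 - x ^ 2 := by nlinarith [hx.1, hx.2]
    have hx1 : 0 < 1 + alpha a Λ * x ^ 2 := by positivity
    have h := im_conj_mul_angularPotential_sub_lambdaBar a hΛ.le s ω m lam hx
    rw [h]
    have hA : 0 ≤ xi a Λ ^ 3 * x ^ 2 / (1 + alpha a Λ * x ^ 2) * normSq ((a : ℂ) * ω) := by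
      positivity
    have hN : 0 ≤ (2 * alpha a Λ * x ^ 2 * (1 + 2 * s ^ 2) * (1 - x ^ 2) * (1 + alpha a Λ * x ^ 2) +
        (xi a Λ * m + s * x * (xi a Λ - 2 * alpha a Λ * (1 - x ^ 2))) ^ 2) /
        ((1 + alpha a Λ * x ^ 2) * (1 - x ^ 2)) :=
      div_nonneg (add_nonneg (mul_nonneg (mul_nonneg (by positivity) hx2.le) hx1.le) (sq_nonneg _))
        (mul_pos hx1 hx2).le
    exact mul_nonneg hcim.le (add_nonneg hA hN)
  · intro x hx hx0
    have hx2 : 0 < 1 - x ^ 2 := by nlinarith [hx.1, hx.2]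
    have hx1 : 0 < 1 + alpha a Λ * x ^ 2 := by positivity
    have h := im_conj_mul_angularPotential_sub_lambdaBar a hΛ.le s ω m lam hx
    rw [h]
    have hxsq : 0 < x ^ 2 := sq_pos_of_ne_zero hx0
    have hA : 0 < xi a Λ ^ 3 * x ^ 2 / (1 + alpha a Λ * x ^ 2) * normSq ((a : ℂ) * ω) := by
      positivity
    have hN : 0 ≤ (2 * alpha a Λ * x ^ 2 * (1 + 2 * s ^ 2) * (1 - x ^ 2) * (1 + alpha a Λ * x ^ 2) +
        (xi a Λ * m + s * x * (xi a Λ - 2 * alpha a Λ * (1 - x ^ 2))) ^ 2) /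
        ((1 + alpha a Λ * x ^ 2) * (1 - x ^ 2)) :=
      div_nonneg (add_nonneg (mul_nonneg (mul_nonneg (by positivity) hx2.le) hx1.le) (sq_nonneg _))
        (mul_pos hx1 hx2).le
    exact mul_pos hcim (add_pos_of_pos_of_nonneg hA hN)

end AngularSignProof

end Literature.Geometry.Lorentzian.KerrDeSitter

end
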